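/-
Origin: expansion seat `planner-pub-hodgecm-pv02-g3-0`, handover 2026-08-18T05:05:23Z (`HOME/pub-hodgecm-pv02-g3/lean/Pv02g3/PerL34/BallCR.lean`, md5 cffde95e, 717 lines);
landed by the gen-6 packager in gate run 22 as `HodgeCM/PerL34/BallCR.lean` (import ^import Pv[0-9]+copy\.(?:PerL34\.)?→import HodgeCM.PerL34. ×1; stripped 7 #print/#check/#eval lines).
-/
/-
Origin: HOME/pub-hodgecm-pv02-g3/lean/Pv02g3/PerL34/BallCR.lean — session planner-pub-hodgecm-pv02-g3-0 (unit
pub-hodgecm-pv02-g3, DAG-NODE PROVER #02 gen 3; pv02 lineage N33b → N33c input `UHolomorphic`).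
Intended final place: `HodgeCM/PerL34/BallCR.lean`; imports the LANDED `HodgeCM.PerL34.{P43_forms, BallDeriv,
BallSpans}` and pv03's run-22 `BallFrame` (here through the verbatim copy `Pv03copy.PerL34.BallFrame`, md5 19a49ace —
PACKAGER: rewrite to `import HodgeCM.PerL34.BallFrame` and land after it).  Mathlib + package only; nothing posited,
nothing cited: every statement below is PROVED.
-/
import Summits.HodgeConjecture.HodgeCM.PerL34.P43_forms
import Summits.HodgeConjecture.HodgeCM.PerL34.BallDeriv
import Summits.HodgeConjecture.HodgeCM.PerL34.BallFrame

/-!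
# (X2) on the ball: Cauchy–Riemann in the moving frame

PerL v5, Prop. 4.3, proof, tex ll. 650–655 (node N33b):
```
650: … for $f\in\Theta_i(\chi'_i)[\fp_+]$ the pair $(f^1,f^2)$ of
651: $\tau$-components is annihilated by $\fp_-$, so $u_f$ is a holomorphic one-form on $\mathbb B^2$ …
```
In the typed cone this is pv14's (X2) `P43Forms.HolomorphicOfPminus FD` ("a `(1,0)`-cochain killed by `𝔭₋` is a
holomorphic one-form", [BW] = Borel–Wallach, *Continuous cohomology, discrete subgroups, and representations of
reductive groups*, 2nd ed., II 4.2 (5)–(6) p. 38 and VII 2.5/2.7 pp. 140–142), so far a PRINT-DERIVED / READING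
label over an ABSTRACT dictionary `FD : FormsDictionary Ginf V` (fields `Pminus`, `Cochain`, `Hol`), carried as the
record field `hX2` of the S1 constructors (`P43WeilModel.groupInputs_of_weilModel`, carver `WeilSpanDatum`, pv14-g2
`WeilBridge`, pv03 `WeilPackage`).

This file PROVES it for the CANONICAL BALL DICTIONARY `ballFD : FormsDictionary U21 (Fin 2 → ℂ)` of pv03's ball
model (`Ball.lean`: `U21 = U(2,1)`, `Ball = 𝔹²`, `x₀ = 0`, Jacobian `Jac`, cotangent cocycle `A`; `BallSpans.R` =
pv14's frame reading `R u g = A g⁻¹ (g·x₀) (u (g·x₀))`; `BallFrame.sec` = the Hermitian boost section `z ↦ g_z`):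

* `Cochain` := the frame readings `R u` of the one-forms `u : 𝔹² → ℂ²` that are real-`C¹` on the open ball
  (`ballC1`), i.e. the `C¹` right-`K`-equivariant `ℂ²`-valued functions on `U(2,1)` (`BallFrame.IsFrameFn`);
* `Hol` := the frame readings of the HOLOMORPHIC one-forms (`ballHol u`: `ℂ`-differentiable at every point of the
  open ball `𝔹² ⊂ ℂ²`);
* `Pminus` := the operators `X⁻_v`, `v ∈ ℂ²`: `X⁻_v F (g) = ∂_t F(g·g_{c_v(t)})|₀ + i·∂_t F(g·g_{c_{iv}(t)})|₀`, the
  right derivative along the boost curves `t ↦ g_{c_v(t)}` (`c_v(t) = (t/(1+t²|v|²))·v`, tangent at `t = 0` to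
  `X_v = ((0,v),(v*,0)) ∈ 𝔭`: `hasDerivAt_secMat_cv`, `Xp_mem`, `secMat_cv_zero`) combined into the `𝔭^{0,1} = 𝔭₋`-combination
  `X_v + i X_{iv}`
  (`J₀(X_v + iX_{iv}) = -i(X_v + iX_{iv})` for the complex structure `J₀ X_v = X_{iv}` of `𝔹² ⊂ ℂ²`); it is made a
  LINEAR endomorphism of all of `U21 → ℂ²` by precomposing with a linear projection onto `Cochain` (P43_forms,
  docstring of `FormsDictionary`: "extended … off smooth functions — only their kernel matters"); on `Cochain` it IS
  the curve derivative (`Xminus_apply_of_mem`).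

Results (all kernel-checked, axioms ⊆ {propext, Classical.choice, Quot.sound}):
* `R_eq_transpose_Jac : R u h = (Jac h x₀)ᵀ *ᵥ u (h • x₀)` — the frame reading is the pullback `ᵗ(dh)_{x₀} u(h x₀)`;
* `Jac_sec_x₀_apply` and `hasDerivAt_Jac_boost : HasDerivAt (t ↦ Jac (sec (c_v t)) x₀ j i) 0 0` — along the boosts the
  canonical automorphy factor is `1 + O(t²)`: NO zeroth-order term in `X⁻_v` (the content of [BW] II 4.2 (6));
* `hasDerivAt_R_boost : HasDerivAt (t ↦ R u (g * sec (c_v t))) (D(g^*u)(0) v) 0` for `u` real-`C¹`, where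
  `g^*u (x) = (Jac g x)ᵀ u(g x)` in coordinates (`pullVec`);
* `holomorphicOfPminus_ball : P43Forms.HolomorphicOfPminus ballFD` — **(X2) KERNEL**: a `C¹` frame function killed
  by every `X⁻_v` is the frame reading of a holomorphic one-form (at `g = g_z`: `D(g_z^*u)(0)` is `ℂ`-linear, and
  `ᵗJac` invertible + `Jac`, `g_z·` holomorphic transfer `ℂ`-linearity to `Du(z)`);
* `Xminus_R_eq_zero_of_hol` — the converse (non-vacuity of the dictionary): frame readings of holomorphic forms ARE
  killed by `𝔭₋`; hence `killed_iff_hol : φ ∈ Cochain → ((∀ X ∈ Pminus, X φ = 0) ↔ φ ∈ Hol)`;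
* `holFrame_ball : φ ∈ ballFD.Hol → Continuous φ ∧ BallFrame.IsFrameFn φ` — so pv03's `HolFrame S` (hence
  `LineSpans.HolFromBall`, `BallFrame.holFromBall_of_frame`) holds BY NAME for every `S` with `S.Hol = ballFD.Hol`.

HOW TO CONSUME (pv14 `P43_bridge` / `P43WeilModel.groupInputs_of_weilModel`, pv14-g2 `WeilBridge`, pv03
`CharSpansWeil.WeilPackage`, carver-g2 `WeilSpanDatum`; all take `(FD : FormsDictionary D.Ginf D.V) (hHol : FD.Hol =
D.Hol) … (hX2 : HolomorphicOfPminus FD)` with `D.Ginf = U21`, `D.V = ℂ²` in the ball model): take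
`FD := BallCR.ballFD` and the `LineSpans` with `S.Hol := BallCR.Hol`; then `hHol := rfl`,
`hX2 := BallCR.holomorphicOfPminus_ball` (KERNEL), `S.HolFromBall := BallCR.holFromBall_of_hol_eq S rfl` (KERNEL),
and the (X1) obligation `ThetaPKilledByPminus ballFD M` says: each theta one-form `u_F` (`F` of `K`-type in
`S[𝔭₊ ⊠ 𝟏]`) is the frame reading of a real-differentiable form with `X⁻_v u_F = 0` for all `v` — by
`killed_iff_hol`, equivalently: `u_F` is holomorphic.

What this does NOT do: it does not touch (X1) (`ThetaPKilledByPminus FD M`: that the theta one-forms of `K`-type in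
`S[𝔭₊ ⊠ 𝟏]` are `C¹` frame functions killed by `𝔭₋` — INPUT(N31) + [BW] VI 4.11, pv14 `P43X1Bridge`), whose clause
"killed by `𝔭₋`" now reads, for `FD := ballFD`, "`∂̄ u_F = 0` in the moving frame" (`killed_iff_hol`).
-/

set_option autoImplicit false

noncomputable section

open Complex ComplexConjugate
open scoped Matrix

namespace HodgeCM
namespace PerL34
namespace BallCR

open HodgeCM.PerL34.BallModel HodgeCM.PerL34.BallSpans HodgeCM.PerL34.BallFrame

/-! ## 1. The frame reading is the pullback `ᵗ(dh)_{x₀} · u(h·x₀)` -/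

/-- `coT h⁻¹ (h·x₀) = (Jac h x₀)ᵀ`: both are two-sided inverses of `(Jac h⁻¹ (h·x₀))ᵀ`. -/
theorem coT_inv_smul (h : U21) : coT h⁻¹ (h • x₀) = (Jac h x₀)ᵀ := by
  have h1 : coT h⁻¹ (h • x₀) * (Jac h⁻¹ (h • x₀))ᵀ = 1 := coT_mul_transpose_Jac h⁻¹ (h • x₀)
  have h2 : (Jac h⁻¹ (h • x₀))ᵀ * (Jac h x₀)ᵀ = 1 := by
    rw [← Matrix.transpose_mul, Jac_mul_inv, Matrix.transpose_one]
  calc coT h⁻¹ (h • x₀) = coT h⁻¹ (h • x₀) * ((Jac h⁻¹ (h • x₀))ᵀ * (Jac h x₀)ᵀ) := by rw [h2, mul_one]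
    _ = (Jac h x₀)ᵀ := by rw [← mul_assoc, h1, one_mul]

/-- **The frame reading is the pullback at the base point**: `R u h = ᵗ(Jac h x₀) · u (h · x₀)`. -/
theorem R_eq_transpose_Jac (u : Ball → (Fin 2 → ℂ)) (h : U21) : R u h = (Jac h x₀)ᵀ *ᵥ u (h • x₀) := by
  rw [R_apply, A_apply, coT_inv_smul]

/-- Along a product: `R u (g * s) = ᵗ(Jac s x₀) · (ᵗ(Jac g (s·x₀)) · u (g · (s · x₀)))`. -/
theorem R_mul (u : Ball → (Fin 2 → ℂ)) (g s : U21) :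
    R u (g * s) = (Jac s x₀)ᵀ *ᵥ ((Jac g (s • x₀))ᵀ *ᵥ u (g • (s • x₀))) := by
  rw [R_eq_transpose_Jac, Jac_mul, Matrix.transpose_mul, ← Matrix.mulVec_mulVec, mul_smul]

/-! ## 2. Coordinates: extension by zero, the Jacobian and the pullback as functions on `ℂ²` -/

/-- Extension of `u : 𝔹² → ℂ²` by `0` to all of `ℂ²` (differentiability of `u` at a point of the OPEN ball is
differentiability of `ext u` there). -/
def ext (u : Ball → (Fin 2 → ℂ)) (y : Fin 2 → ℂ) : Fin 2 → ℂ := if h : nsq y < 1 then u ⟨y, h⟩ else 0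

/-- (Ported verbatim from the HodgeCMPerL package; no docstring in the source.) -/
@[simp] theorem ext_val (u : Ball → (Fin 2 → ℂ)) (z : Ball) : ext u z.1 = u z := by
  simp [ext, z.2]

/-- (Ported verbatim from the HodgeCMPerL package; no docstring in the source.) -/
theorem ext_add (u u' : Ball → (Fin 2 → ℂ)) : ext (u + u') = ext u + ext u' := by
  funext y; by_cases h : nsq y < 1 <;> simp [ext, h]

/-- (Ported verbatim from the HodgeCMPerL package; no docstring in the source.) -/
theorem ext_smul (c : ℂ) (u : Ball → (Fin 2 → ℂ)) : ext (c • u) = c • ext u := by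
  funext y; by_cases h : nsq y < 1 <;> simp [ext, h]

/-- (Ported verbatim from the HodgeCMPerL package; no docstring in the source.) -/
theorem ext_zero : ext (0 : Ball → (Fin 2 → ℂ)) = 0 := by
  funext y; simp only [ext]; split <;> rfl

/-- `u` is real-`C¹` on the open ball: real-Fréchet-differentiable at every point (as a map on `ℂ² ⊃ 𝔹²`). -/
def ballC1 (u : Ball → (Fin 2 → ℂ)) : Prop := ∀ z : Ball, DifferentiableAt ℝ (ext u) z.1

/-- `u` is holomorphic on the open ball: `ℂ`-differentiable at every point. -/
def ballHol (u : Ball → (Fin 2 → ℂ)) : Prop := ∀ z : Ball, DifferentiableAt ℂ (ext u) z.1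

/-- (Ported verbatim from the HodgeCMPerL package; no docstring in the source.) -/
theorem ballC1_of_ballHol {u : Ball → (Fin 2 → ℂ)} (h : ballHol u) : ballC1 u := fun z => (h z).restrictScalars ℝ

/-- The real-`C¹` one-forms, a `ℂ`-subspace of `𝔹² → ℂ²`. -/
def c1Forms : Submodule ℂ (Ball → (Fin 2 → ℂ)) where
  carrier := {u | ballC1 u}
  zero_mem' := fun z => by rw [ext_zero]; exact differentiableAt_const _
  add_mem' := fun {u u'} hu hu' z => by rw [ext_add]; exact (hu z).add (hu' z)
  smul_mem' := fun c u hu z => by rw [ext_smul]; exact (hu z).const_smul c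

/-- The holomorphic one-forms, a `ℂ`-subspace of `𝔹² → ℂ²`. -/
def holForms : Submodule ℂ (Ball → (Fin 2 → ℂ)) where
  carrier := {u | ballHol u}
  zero_mem' := fun z => by rw [ext_zero]; exact differentiableAt_const _
  add_mem' := fun {u u'} hu hu' z => by rw [ext_add]; exact (hu z).add (hu' z)
  smul_mem' := fun c u hu z => by rw [ext_smul]; exact (hu z).const_smul c

/-- (Ported verbatim from the HodgeCMPerL package; no docstring in the source.) -/
@[simp] theorem mem_c1Forms (u : Ball → (Fin 2 → ℂ)) : u ∈ c1Forms ↔ ballC1 u := Iff.rfl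
/-- (Ported verbatim from the HodgeCMPerL package; no docstring in the source.) -/
@[simp] theorem mem_holForms (u : Ball → (Fin 2 → ℂ)) : u ∈ holForms ↔ ballHol u := Iff.rfl

/-- The Jacobian formula of `Ball.Jac` as a function of the coordinate vector `y ∈ ℂ²`. -/
def JacVec (g : U21) (y : Fin 2 → ℂ) : Matrix (Fin 2) (Fin 2) ℂ :=
  Matrix.of fun i j => (mat g (Fin.castSucc i) (Fin.castSucc j) * (mat g *ᵥ ![y 0, y 1, 1]) 2 -
    (mat g *ᵥ ![y 0, y 1, 1]) (Fin.castSucc i) * mat g 2 (Fin.castSucc j)) / (mat g *ᵥ ![y 0, y 1, 1]) 2 ^ 2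

/-- (Ported verbatim from the HodgeCMPerL package; no docstring in the source.) -/
theorem JacVec_val (g : U21) (z : Ball) : JacVec g z.1 = Jac g z := by
  ext i j; rfl

/-- The pullback `g^*u` in coordinates: `pullVec g u y = ᵗ(JacVec g y) · ext u (g · y)`. -/
def pullVec (g : U21) (u : Ball → (Fin 2 → ℂ)) (y : Fin 2 → ℂ) : Fin 2 → ℂ :=
  (JacVec g y)ᵀ *ᵥ ext u (actVec g y)

/-- (Ported verbatim from the HodgeCMPerL package; no docstring in the source.) -/
theorem actVec_zero_eq (g : U21) : actVec g 0 = (g • x₀).1 := actVec_eq g x₀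

/-- (Ported verbatim from the HodgeCMPerL package; no docstring in the source.) -/
theorem pullVec_val (g : U21) (u : Ball → (Fin 2 → ℂ)) (x : Ball) :
    pullVec g u x.1 = (Jac g x)ᵀ *ᵥ u (g • x) := by
  rw [pullVec, JacVec_val, actVec_eq, ext_val]

/-- (Ported verbatim from the HodgeCMPerL package; no docstring in the source.) -/
theorem pullVec_add (g : U21) (u u' : Ball → (Fin 2 → ℂ)) :
    pullVec g (u + u') = fun y => pullVec g u y + pullVec g u' y := by
  funext y; simp [pullVec, ext_add, Matrix.mulVec_add]

/-- (Ported verbatim from the HodgeCMPerL package; no docstring in the source.) -/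
theorem pullVec_smul (g : U21) (c : ℂ) (u : Ball → (Fin 2 → ℂ)) :
    pullVec g (c • u) = fun y => c • pullVec g u y := by
  funext y; simp [pullVec, ext_smul, Matrix.mulVec_smul]

/-! ## 3. The boost curves `c_v(t) = r(t)·v` and the section `g_{c_v(t)}` along them -/

/-- The radial profile `r(t) = t/(1+t²|v|²)`: `r(t)·v ∈ 𝔹²` for every real `t`, `r(0) = 0`, `r'(0) = 1`. -/
def rOf (v : Fin 2 → ℂ) (t : ℝ) : ℝ := t / (1 + t ^ 2 * nsq v)

/-- (Ported verbatim from the HodgeCMPerL package; no docstring in the source.) -/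
theorem one_add_sq_mul_pos (v : Fin 2 → ℂ) (t : ℝ) : 0 < 1 + t ^ 2 * nsq v := by
  have := nsq_nonneg v; positivity

/-- (Ported verbatim from the HodgeCMPerL package; no docstring in the source.) -/
theorem nsq_real_smul (r : ℝ) (v : Fin 2 → ℂ) : nsq ((r : ℂ) • v) = r ^ 2 * nsq v := by
  simp only [nsq, Pi.smul_apply, smul_eq_mul, norm_mul, Complex.norm_real, Real.norm_eq_abs, mul_pow, sq_abs]
  ring

/-- (Ported verbatim from the HodgeCMPerL package; no docstring in the source.) -/
theorem rOf_sq_mul_lt (v : Fin 2 → ℂ) (t : ℝ) : rOf v t ^ 2 * nsq v < 1 := by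
  have ha := nsq_nonneg v
  have hp := one_add_sq_mul_pos v t
  have hta : 0 ≤ t ^ 2 * nsq v := mul_nonneg (sq_nonneg t) ha
  rw [rOf, div_pow, div_mul_eq_mul_div, div_lt_one (by positivity)]
  nlinarith [sq_nonneg (t ^ 2 * nsq v)]

/-- The curve `c_v(t) = r(t)·v` in the ball: through `x₀ = 0` at `t = 0` with velocity `v`. -/
def cv (v : Fin 2 → ℂ) (t : ℝ) : Ball := ⟨(rOf v t : ℂ) • v, by rw [nsq_real_smul]; exact rOf_sq_mul_lt v t⟩

/-- (Ported verbatim from the HodgeCMPerL package; no docstring in the source.) -/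
theorem cv_val (v : Fin 2 → ℂ) (t : ℝ) : (cv v t).1 = (rOf v t : ℂ) • v := rfl

/-- (Ported verbatim from the HodgeCMPerL package; no docstring in the source.) -/
@[simp] theorem rOf_zero (v : Fin 2 → ℂ) : rOf v 0 = 0 := by simp [rOf]

/-- (Ported verbatim from the HodgeCMPerL package; no docstring in the source.) -/
@[simp] theorem cv_zero_val (v : Fin 2 → ℂ) : (cv v 0).1 = 0 := by simp [cv_val]

/-- (Ported verbatim from the HodgeCMPerL package; no docstring in the source.) -/
theorem cv_zero (v : Fin 2 → ℂ) : cv v 0 = x₀ := Ball.ext fun i => by simp [cv_val]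

/-- (Ported verbatim from the HodgeCMPerL package; no docstring in the source.) -/
theorem continuous_rOf (v : Fin 2 → ℂ) : Continuous (rOf v) :=
  continuous_id.div (continuous_const.add ((continuous_pow 2).mul continuous_const))
    fun t => (one_add_sq_mul_pos v t).ne'

/-- (Ported verbatim from the HodgeCMPerL package; no docstring in the source.) -/
theorem continuous_cv (v : Fin 2 → ℂ) : Continuous (cv v) :=
  Continuous.subtype_mk ((Complex.continuous_ofReal.comp (continuous_rOf v)).smul continuous_const) _

/-- (Ported verbatim from the HodgeCMPerL package; no docstring in the source.) -/
theorem hasDerivAt_rOf (v : Fin 2 → ℂ) : HasDerivAt (rOf v) 1 0 := by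
  have h1 : HasDerivAt (fun t : ℝ => 1 + t ^ 2 * nsq v) 0 0 := by
    simpa using ((hasDerivAt_pow 2 (0 : ℝ)).mul_const (nsq v)).const_add (1 : ℝ)
  have h2 := (hasDerivAt_id (0 : ℝ)).fun_div h1 (one_add_sq_mul_pos v 0).ne'
  have h3 : rOf v = fun t => id t / (1 + t ^ 2 * nsq v) := rfl
  rw [h3]
  exact h2.congr_deriv (by simp)

/-- (Ported verbatim from the HodgeCMPerL package; no docstring in the source.) -/
theorem hasDerivAt_ofReal (x : ℝ) : HasDerivAt (fun t : ℝ => (t : ℂ)) 1 x := by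
  simpa using (hasDerivAt_id x).ofReal_comp

/-- `c_v'(0) = v`. -/
theorem hasDerivAt_cv_val (v : Fin 2 → ℂ) : HasDerivAt (fun t => (cv v t).1) v 0 := by
  have := (hasDerivAt_rOf v).ofReal_comp.smul_const v
  simpa [cv_val] using this

/-! ### The canonical automorphy factor along a boost is `1 + O(t²)` -/

/-- The Jacobian of the boost `g_w` at the base point: `Jac g_w (x₀) = (1 + (a-c) w w*) / c`. -/
theorem Jac_sec_x₀_apply (w : Ball) (i j : Fin 2) :
    Jac (sec w) x₀ i j =
      ((if i = j then 1 else 0) + ((aOf w : ℂ) - cOf w) * w.1 i * conj (w.1 j)) / (cOf w : ℂ) := by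
  have hc : (cOf w : ℂ) ≠ 0 := by exact_mod_cast (cOf_pos w).ne'
  fin_cases i <;> fin_cases j <;> simp [Jac, W3_apply, secMat] <;> field_simp <;> ring

/-- (Ported verbatim from the HodgeCMPerL package; no docstring in the source.) -/
theorem tOf_x₀ : tOf x₀ = 1 := by simp [tOf, nsq]

/-- (Ported verbatim from the HodgeCMPerL package; no docstring in the source.) -/
theorem cOf_x₀ : cOf x₀ = 1 := by simp [cOf, tOf_x₀]

/-- At `t = 0` the factor is the identity. -/
theorem Jac_sec_cv_zero (v : Fin 2 → ℂ) (i j : Fin 2) :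
    Jac (sec (cv v 0)) x₀ i j = if i = j then 1 else 0 := by
  rw [cv_zero, Jac_sec_x₀_apply]; simp [cOf_x₀]

/-- (Ported verbatim from the HodgeCMPerL package; no docstring in the source.) -/
theorem tOf_cv (v : Fin 2 → ℂ) (t : ℝ) : tOf (cv v t) = Real.sqrt (1 - rOf v t ^ 2 * nsq v) := by
  rw [tOf, cv_val, nsq_real_smul]

/-- `t ↦ t(c_v(t)) = (1 - r(t)²|v|²)^{1/2}` has derivative `0` at `t = 0`. -/
theorem hasDerivAt_tOf_cv_real (v : Fin 2 → ℂ) : HasDerivAt (fun t => tOf (cv v t)) 0 0 := by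
  have hr := hasDerivAt_rOf v
  have h1 := ((hr.fun_pow 2).mul_const (nsq v)).const_sub (1 : ℝ)
  have h2 := h1.sqrt (by simp)
  have h3 : HasDerivAt (fun t => Real.sqrt (1 - rOf v t ^ 2 * nsq v)) 0 0 := h2.congr_deriv (by simp)
  have h4 : (fun t => tOf (cv v t)) = fun t => Real.sqrt (1 - rOf v t ^ 2 * nsq v) := funext (tOf_cv v)
  rw [h4]; exact h3

/-- (Ported verbatim from the HodgeCMPerL package; no docstring in the source.) -/
theorem hasDerivAt_tOf_cv (v : Fin 2 → ℂ) : HasDerivAt (fun t => (tOf (cv v t) : ℂ)) 0 0 := by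
  simpa using (hasDerivAt_tOf_cv_real v).ofReal_comp

/-- (Ported verbatim from the HodgeCMPerL package; no docstring in the source.) -/
theorem tOf_cv_zero (v : Fin 2 → ℂ) : tOf (cv v 0) = 1 := by rw [cv_zero, tOf_x₀]

/-- (Ported verbatim from the HodgeCMPerL package; no docstring in the source.) -/
theorem hasDerivAt_cOf_cv (v : Fin 2 → ℂ) : HasDerivAt (fun t => (cOf (cv v t) : ℂ)) 0 0 := by
  have h := (hasDerivAt_const (0 : ℝ) (1 : ℝ)).fun_div (hasDerivAt_tOf_cv_real v) (by rw [tOf_cv_zero]; norm_num)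
  have h' : HasDerivAt (fun t => cOf (cv v t)) 0 0 := h.congr_deriv (by simp)
  simpa using h'.ofReal_comp

/-- (Ported verbatim from the HodgeCMPerL package; no docstring in the source.) -/
theorem hasDerivAt_aOf_cv (v : Fin 2 → ℂ) : ∃ a' : ℂ, HasDerivAt (fun t => (aOf (cv v t) : ℂ)) a' 0 := by
  have ht := hasDerivAt_tOf_cv_real v
  have h := (hasDerivAt_const (0 : ℝ) (1 : ℝ)).fun_div (ht.fun_mul (ht.const_add 1))
    (by rw [tOf_cv_zero]; norm_num)
  exact ⟨_, h.ofReal_comp⟩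

/-! ### The boost curves are tangent to `𝔭` at the identity

`𝔲(2,1) = Lie U(2,1) = {X | Xᴴ J + J X = 0} = 𝔨 ⊕ 𝔭` with `𝔭 = {X_v = ((0, v), (v*, 0)) | v ∈ ℂ²}`; the
identification `𝔭 ≅ T_{x₀} 𝔹² = ℂ²` is `X_v ↦ v` (`hasDerivAt_cv_val`: `g_{c_v(t)}·x₀ = c_v(t)` has velocity `v`), so
the complex structure of `𝔹² ⊂ ℂ²` is `J₀ X_v = X_{iv}` and `𝔭^{0,1} = 𝔭₋` is spanned by the `X_v + i X_{iv}`
(`J₀(X_v + iX_{iv}) = -i (X_v + iX_{iv})`).  The next theorem certifies that the curves `t ↦ g_{c_v(t)}` used in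
`Xminus` leave the identity with velocity exactly `X_v`. -/

/-- The matrix `X_v = ((0, v), (v*, 0)) ∈ 𝔭 ⊂ 𝔲(2,1)`. -/
def Xp (v : Fin 2 → ℂ) : Matrix (Fin 3) (Fin 3) ℂ := !![0, 0, v 0; 0, 0, v 1; conj (v 0), conj (v 1), 0]

/-- `X_v ∈ 𝔲(2,1)`: `X_vᴴ J + J X_v = 0`. -/
theorem Xp_mem (v : Fin 2 → ℂ) : (Xp v)ᴴ * J + J * Xp v = 0 := by
  ext i j
  fin_cases i <;> fin_cases j <;>
    simp [Xp, J, Matrix.mul_apply, Matrix.conjTranspose_apply, Matrix.diagonal_apply]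

/-- **The boost curves are tangent to `𝔭`**: `d/dt|₀ (g_{c_v(t)})_{ij} = (X_v)_{ij}` (and `g_{c_v(0)} = 1`). -/
theorem hasDerivAt_secMat_cv (v : Fin 2 → ℂ) (i j : Fin 3) :
    HasDerivAt (fun t : ℝ => secMat (cv v t) i j) (Xp v i j) 0 := by
  have hr : HasDerivAt (fun t => (rOf v t : ℂ)) 1 0 := by simpa using (hasDerivAt_rOf v).ofReal_comp
  have hc := hasDerivAt_cOf_cv v
  obtain ⟨a', ha⟩ := hasDerivAt_aOf_cv v
  have hc0 : (cOf (cv v 0) : ℂ) = 1 := by rw [cv_zero, cOf_x₀]; simp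
  have hcr : ∀ w : ℂ, HasDerivAt (fun t => (cOf (cv v t) : ℂ) * ((rOf v t : ℂ) * w)) w 0 := fun w => by
    have := hc.fun_mul (hr.mul_const w); simpa [hc0] using this
  have hK : ∀ w w' : ℂ,
      HasDerivAt (fun t => (aOf (cv v t) : ℂ) * ((rOf v t : ℂ) * w) * ((rOf v t : ℂ) * w')) 0 0 :=
    fun w w' => by
      have := (ha.fun_mul (hr.mul_const w)).fun_mul (hr.mul_const w'); simpa using this
  fin_cases i <;> fin_cases j <;>
    simp only [secMat, Xp, cv_val, Pi.smul_apply, smul_eq_mul, map_mul, Complex.conj_ofReal, Matrix.of_apply,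
      Matrix.cons_val', Matrix.cons_val_zero, Matrix.cons_val_one, Matrix.empty_val', Matrix.cons_val_fin_one,
      Fin.zero_eta, Fin.mk_one, Fin.isValue, Nat.reduceAdd]
  · simpa using (hK (v 0) (conj (v 0))).const_add (1 : ℂ)
  · exact hK (v 0) (conj (v 1))
  · exact hcr (v 0)
  · exact hK (v 1) (conj (v 0))
  · simpa using (hK (v 1) (conj (v 1))).const_add (1 : ℂ)
  · exact hcr (v 1)
  · exact hcr (conj (v 0))
  · exact hcr (conj (v 1))
  · exact hc

/-- (Ported verbatim from the HodgeCMPerL package; no docstring in the source.) -/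
theorem secMat_cv_zero (v : Fin 2 → ℂ) : secMat (cv v 0) = 1 := by
  rw [cv_zero]
  ext i j
  fin_cases i <;> fin_cases j <;> simp [secMat, cOf_x₀]

/-- Slope lemma: `t ↦ t²·B(t)` has derivative `0` at `0` as soon as `B` is continuous at `0`. -/
theorem hasDerivAt_sq_mul {B : ℝ → ℂ} (hB : ContinuousAt B 0) :
    HasDerivAt (fun t : ℝ => (t : ℂ) ^ 2 * B t) 0 0 := by
  have h1 : HasDerivAt (fun t : ℝ => (t : ℂ) * B t) (B 0) 0 := by
    rw [hasDerivAt_iff_tendsto_slope_zero]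
    have hT : Filter.Tendsto B (nhdsWithin 0 {0}ᶜ) (nhds (B 0)) := hB.tendsto.mono_left nhdsWithin_le_nhds
    refine hT.congr' ?_
    filter_upwards [self_mem_nhdsWithin] with t ht
    have ht' : (t : ℂ) ≠ 0 := by exact_mod_cast ht
    simp only [zero_add, Complex.ofReal_zero, zero_mul, sub_zero, Complex.real_smul, Complex.ofReal_inv]
    field_simp
  have h2 := (hasDerivAt_ofReal 0).fun_mul h1
  have h3 : (fun t : ℝ => (t : ℂ) ^ 2 * B t) = fun t : ℝ => (t : ℂ) * ((t : ℂ) * B t) := by funext t; ring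
  rw [h3]
  exact h2.congr_deriv (by simp)

/-- The second-order coefficient of the boost Jacobian (a continuous function of `t`). -/
def jacB (v : Fin 2 → ℂ) (i j : Fin 2) (t : ℝ) : ℂ :=
  (tOf (cv v t) : ℂ) * ((aOf (cv v t) : ℂ) - cOf (cv v t)) * (((1 / (1 + t ^ 2 * nsq v)) ^ 2 : ℝ) : ℂ) *
    (v i * conj (v j))

/-- (Ported verbatim from the HodgeCMPerL package; no docstring in the source.) -/
theorem continuous_jacB (v : Fin 2 → ℂ) (i j : Fin 2) : Continuous (jacB v i j) := by
  have hc := continuous_cv v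
  have hq : Continuous fun t : ℝ => (1 / (1 + t ^ 2 * nsq v)) ^ 2 :=
    (continuous_const.div (continuous_const.add ((continuous_pow 2).mul continuous_const))
      fun t => (one_add_sq_mul_pos v t).ne').pow 2
  unfold jacB
  exact ((((Complex.continuous_ofReal.comp (continuous_tOf.comp hc)).mul
    ((Complex.continuous_ofReal.comp (continuous_aOf.comp hc)).sub
      (Complex.continuous_ofReal.comp (continuous_cOf.comp hc)))).mul
        (Complex.continuous_ofReal.comp hq)).mul continuous_const)


-- port_pkg: scope closed for this part
end BallCR
end PerL34
end HodgeCM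
end
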